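import Summits.Ventures.Crystal3D.Theorems.StickyWulffConstantGenericWallFloorCoreResidualTwo
import HarnessLib

/-!
# The priced class of lane G stated SEMANTICALLY: pairs whose only co-axial walker tops are in-plane twin pairs, and the
# ARRIVAL residual (crux `GenericWallFloor`, stmt-Ventures-19480, line `WallLedgerG`)

HONEST FRAMING. Venture `Summits/Ventures/Crystal3D` (cell `crystal3d-full`), helper `--supports` the crux
`GenericWallFloor` of `route-Ventures-StickyWulffConstant`, REGISTERED line `WallLedgerG`, open stub
`stub_twoSlabAdhesion`.  Rung credit + bookkeeping; F-C1 not moved; NOT the crux: `ExactOnly`(C12-55) [E1] and `StarPairFar`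
[certified] stay BY NAME.

The three cell files of this seat (`…Sigma9Full`, `…Sigma9FullDown`, `…Sigma27Full`) share ONE composition: the
separation-free ledger `twoSlabAdhesion_stackLedger_cross` plus the in-plane twin pricing `inPlaneTwinStarPair_holds`; only
the word analysis producing the twin data differs.  This file states the composition once, with the twin data as a SEMANTIC
hypothesis on the pair, so that every further cell (any `k`, any `(l,c)` with `l + c ≤ k − 1`) is a word-analysis lemma
away and the residual of the lane is named by what it IS:

* `InPlaneTwinData e₁ e₂` — the conclusion shape of `inPlaneTwin_of_coaxial_sigma9/27`: a unit menu normal `ν` of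
  `e₁.frame` with `e₂.frame·Λ₀ = (twinFrame e₁.frame ν)·Λ₀` and both walk directions in `ν`'s plane;
* `InPlaneTwinOnlyAt A₁ A₂` — SOME steep slot pair `(u₁,u₂)` such that every CO-AXIAL pair of tops of sound well-formed
  stacks (grain 1 over `(A₁,u₁,0)` up, grain 2 over `(A₂,u₂,0)` down) carries `InPlaneTwinData` in one of the two orders;
* **`genericWallFloorAt_of_inPlaneTwinOnlyAt`** — `ExactOnly`(C12-55) → `StarPairFar` → `InPlaneTwinOnlyAt A₁ A₂` →
  `GenericWallFloorAt A₁ t₁ A₂ t₂` (c₀ = 1, verbatim).  Arrivals need no hypothesis: an arriving frame would be co-axial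
  with the other grain's bare bottom, hence a twin of itself (`image_twinFrame_ne`);
* the three syntactic classes are inside it (`inPlaneTwinOnlyAt_of_sigma9OneSidedAt/…DownAt/…sigma27CellAt`);
* `GenericWallFloorArrivalResidual` — the crux's matrix on ray-aligned non-co-axial pairs OUTSIDE `InPlaneTwinOnlyAt`, i.e.
  (for chain pairs) the cells where for every steep slot pair some co-axial pair of tops has EQUAL lattices — one grain's
  forced ray ARRIVES in the other lattice (`Σ9`: `(0,2)/(2,0)/(2,2)`, 17 %; `Σ27` ≈ 20 %; `Σ81` ≈ 19 % of Haar orientations);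
  **`genericWallFloor_of_arrivalResidual`**: `ExactOnly`(C12-55) → `StarPairFar` → `GenericWallFloorArrivalResidual` → the
  route decl BY NAME; converses `…_of_coreResidualTwo`, `…_of_genericWallFloor` (nothing smuggled).
WHAT THIS IS NOT: a proof of the arrival residual (walker end-counting cannot price an arrived walker); F-C1 not moved.
-/

noncomputable section

namespace Summit.Ventures.Crystal3D.Theorems

open Summit.Ventures.Crystal3D Finset
open Literature.MathematicalPhysics.StatisticalMechanics (fccStacking barlowStacking IsHaggSeq contactDeficiency)
open scoped InnerProductSpace

/-- **In-plane twin data** for an ordered pair of walk entries: a unit menu normal `ν` of `e₁.frame` about which `e₂.frame`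
is the mirror twin (as lattices), with both walk directions in `ν`'s plane. -/
def InPlaneTwinData (e₁ e₂ : WalkEntry) : Prop :=
  ∃ ν : EuclideanSpace ℝ (Fin 3), ‖ν‖ = 1 ∧
    (∀ w ∈ fccSlots, ⟪e₁.frame w, ν⟫_ℝ = 0 ∨ ⟪e₁.frame w, ν⟫_ℝ = Real.sqrt (2 / 3) ∨ ⟪e₁.frame w, ν⟫_ℝ = -Real.sqrt (2 / 3)) ∧
    e₂.frame '' fccStacking 1 (Real.sqrt (2 / 3)) = twinFrame e₁.frame ν '' fccStacking 1 (Real.sqrt (2 / 3)) ∧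
    ⟪e₁.frame e₁.dir, ν⟫_ℝ = 0 ∧ ⟪e₂.frame e₂.dir, ν⟫_ℝ = 0

/-- **The priced class, semantically**: some steep up-slot `u₁` of grain 1 and steep down-slot `u₂` of grain 2 such that
every co-axial pair of tops of sound well-formed stacks over `(A₁,u₁,0)` (vertical `e₃`) and `(A₂,u₂,0)` (vertical `−e₃`)
carries in-plane twin data (in one of the two orders). -/
def InPlaneTwinOnlyAt (A₁ A₂ : EuclideanSpace ℝ (Fin 3) ≃ₗᵢ[ℝ] EuclideanSpace ℝ (Fin 3)) : Prop :=
  ∃ u₁ ∈ fccSlots, Real.sqrt 2 / 2 ≤ ⟪A₁ u₁, EuclideanSpace.single (2 : Fin 3) (1 : ℝ)⟫_ℝ ∧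
  ∃ u₂ ∈ fccSlots, ⟪A₂ u₂, EuclideanSpace.single (2 : Fin 3) (1 : ℝ)⟫_ℝ ≤ -(Real.sqrt 2 / 2) ∧
    ∀ (e₁ e₂ : WalkEntry) (rest₁ rest₂ : List WalkEntry),
      StackSound (EuclideanSpace.single (2 : Fin 3) (1 : ℝ)) (e₁ :: rest₁) →
      StackWF (EuclideanSpace.single (2 : Fin 3) (1 : ℝ)) (e₁ :: rest₁) → (e₁ :: rest₁).getLast? = some ⟨A₁, u₁, 0⟩ →
      StackSound (-EuclideanSpace.single (2 : Fin 3) (1 : ℝ)) (e₂ :: rest₂) →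
      StackWF (-EuclideanSpace.single (2 : Fin 3) (1 : ℝ)) (e₂ :: rest₂) → (e₂ :: rest₂).getLast? = some ⟨A₂, u₂, 0⟩ →
      (∃ (L : EuclideanSpace ℝ (Fin 3) ≃ₗᵢ[ℝ] EuclideanSpace ℝ (Fin 3))
          (s₁ s₂ : EuclideanSpace ℝ (Fin 3)) (σ σ' : ℤ → ℤ), IsHaggSeq σ ∧ IsHaggSeq σ' ∧
          e₁.frame '' fccStacking 1 (Real.sqrt (2 / 3)) ⊆ (fun p => L p + s₁) '' barlowStacking 1 (Real.sqrt (2 / 3)) σ ∧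
          e₂.frame '' fccStacking 1 (Real.sqrt (2 / 3)) ⊆ (fun p => L p + s₂) '' barlowStacking 1 (Real.sqrt (2 / 3)) σ') →
      InPlaneTwinData e₁ e₂ ∨ InPlaneTwinData e₂ e₁

/-- **The ARRIVAL residual of lane G**: the crux's matrix, verbatim, on every non-co-axial ray-aligned pair outside the
semantic priced class. -/
def GenericWallFloorArrivalResidual : Prop :=
  ∀ (A₁ : EuclideanSpace ℝ (Fin 3) ≃ₗᵢ[ℝ] EuclideanSpace ℝ (Fin 3)) (t₁ : EuclideanSpace ℝ (Fin 3))
    (A₂ : EuclideanSpace ℝ (Fin 3) ≃ₗᵢ[ℝ] EuclideanSpace ℝ (Fin 3)) (t₂ : EuclideanSpace ℝ (Fin 3)),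
    ¬ (∃ (L : EuclideanSpace ℝ (Fin 3) ≃ₗᵢ[ℝ] EuclideanSpace ℝ (Fin 3)) (s₁ s₂ : EuclideanSpace ℝ (Fin 3))
        (σ σ' : ℤ → ℤ), IsHaggSeq σ ∧ IsHaggSeq σ' ∧
        (fun p => A₁ p + t₁) '' fccStacking 1 (Real.sqrt (2 / 3)) ⊆
          (fun p => L p + s₁) '' barlowStacking 1 (Real.sqrt (2 / 3)) σ ∧
        (fun p => A₂ p + t₂) '' fccStacking 1 (Real.sqrt (2 / 3)) ⊆
          (fun p => L p + s₂) '' barlowStacking 1 (Real.sqrt (2 / 3)) σ') →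
    RayAlignedAt A₁ A₂ → ¬ InPlaneTwinOnlyAt A₁ A₂ → GenericWallFloorAt A₁ t₁ A₂ t₂

/-- A frame carrying in-plane twin data against itself-as-a-lattice is absurd: the twin moves the lattice. -/
theorem false_of_inPlaneTwinData_of_image_eq {e₁ e₂ : WalkEntry}
    (h : InPlaneTwinData e₁ e₂ ∨ InPlaneTwinData e₂ e₁)
    (hEq : e₁.frame '' fccStacking 1 (Real.sqrt (2 / 3)) = e₂.frame '' fccStacking 1 (Real.sqrt (2 / 3))) : False := by
  rcases h with ⟨ν, hν, hmenu, himg, -, -⟩ | ⟨ν, hν, hmenu, himg, -, -⟩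
  · exact image_twinFrame_ne e₁.frame hν hmenu (himg.symm.trans hEq.symm)
  · exact image_twinFrame_ne e₂.frame hν hmenu (himg.symm.trans hEq)

open scoped Classical in
/-- **The composition, once**: on the semantic priced class the crux's matrix holds at FULL charge `c₀ = 1`, modulo
`ExactOnly`(C12-55) and `StarPairFar`. -/
theorem genericWallFloorAtCharge_one_of_inPlaneTwinOnlyAt
    {s₀ : EuclideanSpace ℝ (Fin 3)} (hs₀ : s₀ ∈ fccSlots)
    (hcert : ExactOnly 0 (fccSlots.filter fun w => 0 < ⟪w, s₀⟫_ℝ)) (hfar : StarPairFar)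
    {A₁ A₂ : EuclideanSpace ℝ (Fin 3) ≃ₗᵢ[ℝ] EuclideanSpace ℝ (Fin 3)} (h : InPlaneTwinOnlyAt A₁ A₂)
    (t₁ t₂ : EuclideanSpace ℝ (Fin 3)) : GenericWallFloorAtCharge 1 A₁ t₁ A₂ t₂ := by
  obtain ⟨u₁, hu₁, hsteep₁, u₂, hu₂, hsteep₂, htwin⟩ := h
  set e₃ : EuclideanSpace ℝ (Fin 3) := EuclideanSpace.single (2 : Fin 3) (1 : ℝ) with he₃
  have hsteep₂' : Real.sqrt 2 / 2 ≤ ⟪A₂ u₂, -e₃⟫_ℝ := by rw [inner_neg_right]; linarith only [hsteep₂]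
  -- the trivial stacks on both sides
  have hS₀₁ : StackSound e₃ [⟨A₁, u₁, 0⟩] := ⟨hu₁, hsteep₁⟩
  have hW₀₁ : StackWF e₃ [⟨A₁, u₁, 0⟩] := rfl
  have hS₀₂ : StackSound (-e₃) [⟨A₂, u₂, 0⟩] := ⟨hu₂, hsteep₂'⟩
  have hW₀₂ : StackWF (-e₃) [⟨A₂, u₂, 0⟩] := rfl
  -- (a) no grain-1 stack frame is `A₂·Λ₀`
  have hfar₁ : ∀ stk : List WalkEntry, StackSound e₃ stk → StackWF e₃ stk → stk.getLast? = some ⟨A₁, u₁, 0⟩ →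
      ∀ e ∈ stk, e.frame '' fccStacking 1 (Real.sqrt (2 / 3)) ≠ A₂ '' fccStacking 1 (Real.sqrt (2 / 3)) := by
    intro stk hS hW hl e he hEq
    obtain ⟨r, hS', hW', hl'⟩ := exists_suffix_of_mem stk e he hS hW
    rw [hl] at hl'
    have hco := coaxial_linear_of_image_eq (F₁ := e.frame) (F₂ := (⟨A₂, u₂, 0⟩ : WalkEntry).frame) hEq
    exact false_of_inPlaneTwinData_of_image_eq (htwin e ⟨A₂, u₂, 0⟩ r [] hS' hW' hl' hS₀₂ hW₀₂ rfl hco) hEq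
  -- (b) no grain-2 stack frame is `A₁·Λ₀`
  have hfar₂ : ∀ stk : List WalkEntry, StackSound (-e₃) stk → StackWF (-e₃) stk → stk.getLast? = some ⟨A₂, u₂, 0⟩ →
      ∀ e ∈ stk, e.frame '' fccStacking 1 (Real.sqrt (2 / 3)) ≠ A₁ '' fccStacking 1 (Real.sqrt (2 / 3)) := by
    intro stk hS hW hl e he hEq
    obtain ⟨r, hS', hW', hl'⟩ := exists_suffix_of_mem stk e he hS hW
    rw [hl] at hl'
    have hco := coaxial_linear_of_image_eq (F₁ := (⟨A₁, u₁, 0⟩ : WalkEntry).frame) (F₂ := e.frame) hEq.symm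
    exact false_of_inPlaneTwinData_of_image_eq (htwin ⟨A₁, u₁, 0⟩ e [] r hS₀₁ hW₀₁ rfl hS' hW' hl' hco) hEq.symm
  -- (c) the priced cross pairs
  have hledger := twoSlabAdhesion_stackLedger_cross hs₀ hcert (doubleStarCoaxialAt_of_starPairFar hfar)
    (capPairCoaxial_of_starPairFar hfar) A₁ t₁ A₂ t₂ hu₁ hsteep₁ hu₂ hsteep₂ hfar₁ hfar₂
    (fun stk₁ stk₂ e₁ e₂ rest₁ rest₂ hS₁ hW₁ hl₁ hst₁ hS₂ hW₂ hl₂ hst₂ => by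
      by_cases hco : ∃ (L : EuclideanSpace ℝ (Fin 3) ≃ₗᵢ[ℝ] EuclideanSpace ℝ (Fin 3))
          (s₁ s₂ : EuclideanSpace ℝ (Fin 3)) (σ σ' : ℤ → ℤ), IsHaggSeq σ ∧ IsHaggSeq σ' ∧
          e₁.frame '' fccStacking 1 (Real.sqrt (2 / 3)) ⊆ (fun p => L p + s₁) '' barlowStacking 1 (Real.sqrt (2 / 3)) σ ∧
          e₂.frame '' fccStacking 1 (Real.sqrt (2 / 3)) ⊆ (fun p => L p + s₂) '' barlowStacking 1 (Real.sqrt (2 / 3)) σ'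
      · right
        subst hst₁; subst hst₂
        intro Y hY y hy hown₁ hown₂
        rcases htwin e₁ e₂ rest₁ rest₂ hS₁ hW₁ hl₁ hS₂ hW₂ hl₂ hco with ⟨ν, hν, hmenu, himg, hd₁, hd₂⟩ | ⟨ν, hν, hmenu, himg, hd₂, hd₁⟩
        · exact ⟨starSet_ne_of_inPlaneTwin hν hmenu himg hS₁.top.1 hd₁,
            cover_of_inPlaneTwinStarPair inPlaneTwinStarPair_holds hY hν hmenu himg hS₁.top.1 hS₂.top.1 hd₁ hd₂ hy
              hown₁ hown₂⟩
        · refine ⟨(starSet_ne_of_inPlaneTwin hν hmenu himg hS₂.top.1 hd₂ (v₂ := e₁.dir) (e := y)).symm,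
            fun q hq hqd => ?_⟩
          rw [Finset.union_comm]
          exact cover_of_inPlaneTwinStarPair inPlaneTwinStarPair_holds hY hν hmenu himg hS₂.top.1 hS₁.top.1 hd₂ hd₁ hy
            hown₂ hown₁ q hq hqd
      · exact Or.inl hco)
  -- (d) the skeleton composition and the charge `½(κ₁ + κ₂) ≥ 1`
  have hκ₁ := one_le_flux_of_steep (A := A₁) (u := u₁) (le_trans hsteep₁ (le_abs_self _))
  have hκ₂ : 1 ≤ Real.sqrt 2 * |⟪A₂ u₂, EuclideanSpace.single (2 : Fin 3) (1 : ℝ)⟫_ℝ| := by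
    refine one_le_flux_of_steep (A := A₂) (u := u₂) ?_
    rw [abs_of_nonpos (by linarith only [hsteep₂, Real.sqrt_nonneg 2] :
      ⟪A₂ u₂, EuclideanSpace.single (2 : Fin 3) (1 : ℝ)⟫_ℝ ≤ 0)]
    linarith only [hsteep₂]
  exact genericWallFloorAtCharge_mono (by linarith only [hκ₁, hκ₂])
    (genericWallFloorAtCharge_of_ledger _ A₁ t₁ A₂ t₂ hledger)

/-- `GenericWallFloorAt` (the route decl's matrix) on the semantic priced class, modulo `ExactOnly`(C12-55), `StarPairFar`. -/
theorem genericWallFloorAt_of_inPlaneTwinOnlyAt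
    {s₀ : EuclideanSpace ℝ (Fin 3)} (hs₀ : s₀ ∈ fccSlots)
    (hcert : ExactOnly 0 (fccSlots.filter fun w => 0 < ⟪w, s₀⟫_ℝ)) (hfar : StarPairFar)
    {A₁ A₂ : EuclideanSpace ℝ (Fin 3) ≃ₗᵢ[ℝ] EuclideanSpace ℝ (Fin 3)} (h : InPlaneTwinOnlyAt A₁ A₂)
    (t₁ t₂ : EuclideanSpace ℝ (Fin 3)) : GenericWallFloorAt A₁ t₁ A₂ t₂ :=
  genericWallFloorAt_of_charge_one (genericWallFloorAtCharge_one_of_inPlaneTwinOnlyAt hs₀ hcert hfar h t₁ t₂)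

/-- The lower one-sided `Σ9` class lies in the semantic priced class. -/
theorem inPlaneTwinOnlyAt_of_sigma9OneSidedAt {A₁ A₂ : EuclideanSpace ℝ (Fin 3) ≃ₗᵢ[ℝ] EuclideanSpace ℝ (Fin 3)}
    (h : Sigma9OneSidedAt A₁ A₂) : InPlaneTwinOnlyAt A₁ A₂ := by
  obtain ⟨u₁, u₂, μk, μk1, hu₁, hsteep₁, hu₂, hsteep₂, hκl, hκc, hA₂, hfirst, hsecond, hcap⟩ := h
  refine ⟨u₁, hu₁, hsteep₁, u₂, hu₂, hsteep₂, fun e₁ e₂ rest₁ rest₂ hS₁ hW₁ hl₁ hS₂ hW₂ hl₂ hco => Or.inl ?_⟩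
  obtain ⟨hν, hmenu, himg, hd₁, hd₂⟩ := inPlaneTwin_of_coaxial_sigma9 μk μk1 hκl hκc hA₂ hfirst hsecond hcap
    hS₁ hW₁ hl₁ hS₂ hW₂ hl₂ hco
  exact ⟨A₁ μk1, hν, hmenu, himg, hd₁, hd₂⟩

/-- The upper one-sided `Σ9` class lies in the semantic priced class (twin data in the swapped order). -/
theorem inPlaneTwinOnlyAt_of_sigma9OneSidedDownAt {A₁ A₂ : EuclideanSpace ℝ (Fin 3) ≃ₗᵢ[ℝ] EuclideanSpace ℝ (Fin 3)}
    (h : Sigma9OneSidedDownAt A₁ A₂) : InPlaneTwinOnlyAt A₁ A₂ := by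
  obtain ⟨u₁, u₂, μk, μk1, hu₁, hsteep₁, hu₂, hsteep₂, hκl, hκc, hA₁, hfirst, hsecond, hcap⟩ := h
  refine ⟨u₁, hu₁, hsteep₁, u₂, hu₂, hsteep₂, fun e₁ e₂ rest₁ rest₂ hS₁ hW₁ hl₁ hS₂ hW₂ hl₂ hco => Or.inr ?_⟩
  obtain ⟨hν, hmenu, himg, hd₂, hd₁⟩ := inPlaneTwin_of_coaxial_sigma9 (A₁ := A₂) (A₂ := A₁) μk μk1 hκl hκc hA₁
    hfirst hsecond hcap hS₂ hW₂ hl₂ hS₁ hW₁ hl₁ (coaxial_linear_symm hco)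
  exact ⟨A₂ μk1, hν, hmenu, himg, hd₂, hd₁⟩

/-- The `Σ27` both-sides-level-two class lies in the semantic priced class. -/
theorem inPlaneTwinOnlyAt_of_sigma27CellAt {A₁ A₂ : EuclideanSpace ℝ (Fin 3) ≃ₗᵢ[ℝ] EuclideanSpace ℝ (Fin 3)}
    (h : Sigma27CellAt A₁ A₂) : InPlaneTwinOnlyAt A₁ A₂ := by
  obtain ⟨u₁, u₂, μ₃, μ₂, μ₁, hu₁, hsteep₁, hu₂, hsteep₂, hκl, hκc, hA₂, hsecond₁, hcap₁, hsecond₂, hcap₂⟩ := h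
  exact ⟨u₁, hu₁, hsteep₁, u₂, hu₂, hsteep₂, fun e₁ e₂ rest₁ rest₂ hS₁ hW₁ hl₁ hS₂ hW₂ hl₂ hco =>
    Or.inl (inPlaneTwin_of_coaxial_sigma27 μ₃ μ₂ μ₁ hκl hκc hA₂ hsecond₁ hcap₁ hsecond₂ hcap₂ hS₁ hW₁ hl₁ hS₂ hW₂ hl₂
      hco)⟩

/-- **The crux BY NAME from `ExactOnly`(C12-55), `StarPairFar` and the ARRIVAL residual.** -/
theorem genericWallFloor_of_arrivalResidual
    {s₀ : EuclideanSpace ℝ (Fin 3)} (hs₀ : s₀ ∈ fccSlots)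
    (hcert : ExactOnly 0 (fccSlots.filter fun w => 0 < ⟪w, s₀⟫_ℝ)) (hfar : StarPairFar)
    (hres : GenericWallFloorArrivalResidual) :
    Summit.Ventures.Crystal3D.Theses.StickyWulffConstant.GenericWallFloor := by
  refine genericWallFloor_of_core hs₀ hcert hfar fun A₁ t₁ A₂ t₂ hnc hra => ?_
  by_cases h : InPlaneTwinOnlyAt A₁ A₂
  · exact genericWallFloorAt_of_inPlaneTwinOnlyAt hs₀ hcert hfar h t₁ t₂
  exact hres A₁ t₁ A₂ t₂ hnc hra h

/-- The arrival residual is implied by the twice-shrunk syntactic residual: nothing is smuggled. -/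
theorem genericWallFloorArrivalResidual_of_coreResidualTwo (h : GenericWallFloorCoreResidualTwo) :
    GenericWallFloorArrivalResidual :=
  fun A₁ t₁ A₂ t₂ hnc hra hn => h A₁ t₁ A₂ t₂ hnc hra (fun h₁ => hn (inPlaneTwinOnlyAt_of_sigma9OneSidedAt h₁))
    (fun h₂ => hn (inPlaneTwinOnlyAt_of_sigma9OneSidedDownAt h₂)) (fun h₃ => hn (inPlaneTwinOnlyAt_of_sigma27CellAt h₃))

/-- The crux implies the arrival residual. -/
theorem genericWallFloorArrivalResidual_of_genericWallFloor
    (h : Summit.Ventures.Crystal3D.Theses.StickyWulffConstant.GenericWallFloor) : GenericWallFloorArrivalResidual :=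
  genericWallFloorArrivalResidual_of_coreResidualTwo
    (genericWallFloorCoreResidualTwo_of_coreResidual
      (genericWallFloorCoreResidual_of_core (genericWallFloorCore_of_genericWallFloor h)))

end Summit.Ventures.Crystal3D.Theorems

end
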